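import Literature.Barriers.AtomisticToContinuum.DisorderedHarmonicChainDensityUpperEstimates
import Mathlib.MeasureTheory.Integral.IntervalIntegral.FundThmCalculus
import Mathlib.MeasureTheory.Integral.IntervalIntegral.Periodic
import Mathlib.MeasureTheory.Integral.DominatedConvergence
import Mathlib.Analysis.Calculus.Deriv.Shift
import HarnessLib

/-!
# Ajanki–Huveneers 2011, Prop. 5.1 upper bound (5.1) for continuous test functions, by integration by parts

Assembly file of the integration-by-parts route (`…DensityUpperDefs/Bounds/Estimates.lean`) to
"`𝔼(e^{w∑_{k=1}^n h(X^x_{k-1})B_k} u(X^x_n)) ≤ (K/(w√n)) ∫_𝕋 u(y) dy` (`wn ≥ κ`, `w²n ≤ 1`)" of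
Prop. 5.1 of O. Ajanki, F. Huveneers, CMP **301** (2011) 841–883, arXiv:1003.1076 — here for
CONTINUOUS `1`-periodic `u ≥ 0` (`density_upper_continuous`; the extension to all integrable `u` is
measure-theoretic routine, next file). PROVED, in order:

* the periodic primitive `G₀` of `u - ∫_𝕋u` with `|G₀| ≤ 2∫_𝕋u` (`exists_periodic_primitive`);
* the oscillation of the weight `e^{T}` along one coordinate of the last window is `e^{𝒪(w)}`
  (`exp_duT_update_le`), feeding the weighted crude bound of `…DensityCrude.lean` on the bad event
  `{N_{m₁} < 2νm₁}` (probability `≤ e^{-cm₁}`, `…Moments.lean`);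
* the good part: `|𝔼[g₀(X_n) e^T χ]| ≤ 2(∫_𝕋u) K₁/(w√n)` (`good_part_bound`: `integral_core_le`,
  `core_bound_algebra`, and `ε → 0` by dominated convergence);
* the assembly `𝔼[e^T u(X_n)] = (∫_𝕋u)𝔼e^T + 𝔼[g₀(X_n)e^Tχ] + 𝔼[g₀(X_n)e^T(1-χ)]`.

[cite: AjankiHuveneers2011, Prop. 5.1 eq. (5.1)] (statement); the proof given here is an alternative to
the paper's Lemmas 5.2–5.5 (its Lemma 5.3 is refuted as printed in `…RyCounterexample.lean`). [folklore]
-/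

noncomputable section

open Real MeasureTheory Set Filter Function Finset Topology
open scoped ENNReal

namespace Literature.Barriers.AtomisticToContinuum.HeatConduction

/-! ### The periodic primitive of a centred continuous periodic function -/

section Primitive

/-- **Periodic primitive.** For a continuous `1`-periodic `φ ≥ 0` with mean `μ₀ = ∫_{[0,1)} φ`, the
function `G₀(y) = ∫_0^y (φ - μ₀)` satisfies `G₀' = φ - μ₀`, is `1`-periodic and `|G₀| ≤ 2μ₀`.
[folklore] -/
theorem exists_periodic_primitive {φ : ℝ → ℝ} (hφ : Continuous φ) (hper : Function.Periodic φ 1)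
    (hφ0 : ∀ y, 0 ≤ φ y) :
    ∃ G : ℝ → ℝ, (∀ y, HasDerivAt G (φ y - ∫ t in Set.Ico (0 : ℝ) 1, φ t) y) ∧ Function.Periodic G 1 ∧
      ∀ y, |G y| ≤ 2 * ∫ t in Set.Ico (0 : ℝ) 1, φ t := by
  set μ₀ : ℝ := ∫ t in Set.Ico (0 : ℝ) 1, φ t with hμ₀
  have hμ₀' : μ₀ = ∫ t in (0 : ℝ)..1, φ t := by
    rw [intervalIntegral.integral_of_le zero_le_one, hμ₀, integral_Ico_eq_integral_Ioc]
  have hμ₀0 : 0 ≤ μ₀ := by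
    rw [hμ₀']; exact intervalIntegral.integral_nonneg zero_le_one fun t _ => hφ0 t
  set f : ℝ → ℝ := fun t => φ t - μ₀ with hf
  have hfc : Continuous f := hφ.sub continuous_const
  have hfper : Function.Periodic f 1 := fun t => by simp only [hf, hper t]
  set G : ℝ → ℝ := fun y => ∫ t in (0 : ℝ)..y, f t with hG
  have hderiv : ∀ y, HasDerivAt G (f y) y := fun y =>
    intervalIntegral.integral_hasDerivAt_right (hfc.intervalIntegrable _ _) (hfc.stronglyMeasurableAtFilter _ _)
      hfc.continuousAt
  have hmean : ∫ t in (0 : ℝ)..1, f t = 0 := by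
    rw [hf]
    rw [intervalIntegral.integral_sub (hφ.intervalIntegrable _ _) (intervalIntegrable_const), ← hμ₀',
      intervalIntegral.integral_const]
    simp
  have hGper : Function.Periodic G 1 := by
    intro y
    simp only [hG]
    rw [← intervalIntegral.integral_add_adjacent_intervals (hfc.intervalIntegrable 0 y) (hfc.intervalIntegrable y (y + 1)),
      hfper.intervalIntegral_add_eq y 0, zero_add, hmean, add_zero]
  refine ⟨G, hderiv, hGper, fun y => ?_⟩
  -- reduce to `y ∈ [0, 1)` and bound by `∫_0^1 |f| ≤ 2μ₀`
  have hred : G y = G (Int.fract y) := by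
    rw [Int.fract, show (y - ⌊y⌋ : ℝ) = y - (⌊y⌋ : ℤ) * (1 : ℝ) by ring, hGper.sub_int_mul_eq]
  rw [hred]
  set y' : ℝ := Int.fract y with hy'
  have hy0 : 0 ≤ y' := Int.fract_nonneg y
  have hy1 : y' ≤ 1 := (Int.fract_lt_one y).le
  calc |G y'| = |∫ t in (0 : ℝ)..y', f t| := rfl
    _ ≤ ∫ t in (0 : ℝ)..y', |f t| := intervalIntegral.abs_integral_le_integral_abs hy0
    _ ≤ ∫ t in (0 : ℝ)..1, |f t| :=
        intervalIntegral.integral_mono_interval le_rfl hy0 hy1 (ae_of_all _ fun t => abs_nonneg _)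
          (hfc.abs.intervalIntegrable _ _)
    _ ≤ ∫ t in (0 : ℝ)..1, (φ t + μ₀) := by
        refine intervalIntegral.integral_mono_on zero_le_one (hfc.abs.intervalIntegrable _ _)
          ((hφ.add continuous_const).intervalIntegrable _ _) fun t _ => ?_
        simp only [hf]
        exact abs_le.mpr ⟨by linarith [hφ0 t], by linarith⟩
    _ = 2 * μ₀ := by
        rw [intervalIntegral.integral_add (hφ.intervalIntegrable _ _) intervalIntegrable_const, ← hμ₀',
          intervalIntegral.integral_const]
        simp; ring

end Primitive

/-! ### The window: `∂_jX_k = 𝒪(w)` and the oscillation of `e^T` along one window coordinate -/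

section Window

variable {w x M : ℝ}

-- keep the unifier from unfolding the trigonometric polynomials and the chain (expensive `whnf`)
attribute [local irreducible] pcP pcPx pcPd ahPhase igDelta

/-- **`0 ≤ ∂X_k/∂B_j ≤ 6w` inside a window of `w`-length `≤ 1/(5πb_*)`** (`j < k`,
`5πwM(k-j) ≤ 1`). [cite: AjankiHuveneers2011, Lemma 3.2 eq. (3.11) and Prop. 3.5 eq. (3.21)] -/
theorem vaDX_le_of_window (hM : 0 ≤ M) (hw0 : 0 < w) (hw : w ≤ pcW M) {B : ℕ → ℝ}
    (hB : ∀ i, |B i| ≤ M) {j k : ℕ} (hjk : j < k) (hwin : 5 * π * w * M * ((k - j : ℕ) : ℝ) ≤ 1) :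
    0 ≤ vaDX w x B j k ∧ vaDX w x B j k ≤ 6 * w := by
  obtain ⟨hw2, -, -⟩ := pc_small hM hw0.le hw (hB 0)
  have hwπ : π * w / 2 < 1 := by linarith
  refine ⟨vaDX_nonneg B hw0 hwπ j k, ?_⟩
  rw [vaDX_eq hw0 hwπ B hjk]
  obtain ⟨-, hr⟩ := vaJ_ratio_bounds (x := x) hM hw0.le hw hB j (k - j)
  rw [show j + (k - j) = k by omega] at hr
  have hJj := vaJ_pos w x B j
  have hJk := vaJ_pos w x B k
  have hu := vaU_bounds w x B j
  have hc_hi := igC_le hw0.le hw2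
  have hc0 := (igC_pos hw0 hwπ).le
  have hratio : vaJ w x B k / vaJ w x B j ≤ 3 :=
    hr.trans ((Real.exp_le_exp.mpr (by linarith)).trans Real.exp_one_lt_three.le)
  have heq : vaU w x B j * vaJ w x B k * igC w / (π * vaJ w x B j) =
      vaU w x B j * (vaJ w x B k / vaJ w x B j) * (igC w / π) := by field_simp
  rw [heq]
  calc vaU w x B j * (vaJ w x B k / vaJ w x B j) * (igC w / π) ≤ 2 * 3 * (π * w / π) := by
        refine mul_le_mul (mul_le_mul hu.2 hratio (div_nonneg hJk.le hJj.le) (by norm_num)) ?_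
          (by positivity) (by norm_num)
        exact div_le_div_of_nonneg_right hc_hi Real.pi_pos.le
    _ = 6 * w := by field_simp; ring

/-- **`|∂_jT_N| ≤ w(H + 6wMH'(N-j))`** along a window coordinate `j` (`5πwM(N-j) ≤ 1`).
[folklore] -/
theorem abs_duDT_le_of_window (hM : 0 ≤ M) (hw0 : 0 < w) (hw : w ≤ pcW M) {B : ℕ → ℝ}
    (hB : ∀ i, |B i| ≤ M) {h : ℝ → ℝ} {H H' : ℝ} (hH : ∀ y, |h y| ≤ H) (hH' : ∀ y, |deriv h y| ≤ H')
    {N j : ℕ} (hjN : j < N) (hwin : 5 * π * w * M * ((N - j : ℕ) : ℝ) ≤ 1) :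
    |duDT w x h B N j| ≤ w * (H + 6 * w * M * H' * ((N - j : ℕ) : ℝ)) := by
  obtain ⟨hw2, -, -⟩ := pc_small hM hw0.le hw (hB 0)
  have hwπ : π * w / 2 < 1 := by linarith
  have hH0 : 0 ≤ H := (abs_nonneg _).trans (hH 0)
  have hH'0 : 0 ≤ H' := (abs_nonneg _).trans (hH' 0)
  unfold duDT
  rw [abs_mul, abs_of_pos hw0]
  refine mul_le_mul_of_nonneg_left ?_ hw0.le
  rw [Finset.sum_add_distrib, Finset.sum_ite_eq' (Finset.range N) j, if_pos (Finset.mem_range.mpr hjN)]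
  refine (abs_add_le _ _).trans ?_
  rw [add_comm]
  refine add_le_add (hH _) ?_
  -- the derivative sum: zero for `k ≤ j`, `≤ H' · 6w · M` for `j < k < N`
  have hterm : ∀ k ∈ Finset.range N, |deriv h (ahPhase w x B k) * vaDX w x B j k * B k| ≤
      if j < k then H' * (6 * w) * M else 0 := by
    intro k hk
    have hkN := Finset.mem_range.mp hk
    by_cases hjk : j < k
    · rw [if_pos hjk, abs_mul, abs_mul]
      have hwin' : 5 * π * w * M * ((k - j : ℕ) : ℝ) ≤ 1 := by
        refine le_trans (mul_le_mul_of_nonneg_left ?_ (by positivity)) hwin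
        exact_mod_cast (show k - j ≤ N - j by omega)
      obtain ⟨hD0, hD⟩ := vaDX_le_of_window (x := x) hM hw0 hw hB hjk hwin'
      rw [abs_of_nonneg hD0]
      exact mul_le_mul (mul_le_mul (hH' _) hD hD0 hH'0) (hB k) (abs_nonneg _) (by positivity)
    · rw [if_neg hjk, vaDX_of_le w x B (not_lt.mp hjk), mul_zero, zero_mul, abs_zero]
  calc |∑ k ∈ Finset.range N, deriv h (ahPhase w x B k) * vaDX w x B j k * B k|
      ≤ ∑ k ∈ Finset.range N, |deriv h (ahPhase w x B k) * vaDX w x B j k * B k| := Finset.abs_sum_le_sum_abs _ _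
    _ ≤ ∑ k ∈ Finset.range N, (if j < k then H' * (6 * w) * M else 0) := Finset.sum_le_sum hterm
    _ = ((Finset.range N).filter fun k => j < k).card * (H' * (6 * w) * M) := by
        rw [← Finset.sum_filter, Finset.sum_const, nsmul_eq_mul]
    _ ≤ ((N - j : ℕ) : ℝ) * (H' * (6 * w) * M) := by
        refine mul_le_mul_of_nonneg_right ?_ (by positivity)
        have : ((Finset.range N).filter fun k => j < k) ⊆ Finset.Ioo j N := by
          intro k hk
          simp only [Finset.mem_filter, Finset.mem_range] at hk
          exact Finset.mem_Ioo.mpr ⟨hk.2, hk.1⟩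
        calc (((Finset.range N).filter fun k => j < k).card : ℝ) ≤ (Finset.Ioo j N).card := by
              exact_mod_cast Finset.card_le_card this
          _ = ((N - j - 1 : ℕ) : ℝ) := by rw [Nat.card_Ioo]
          _ ≤ ((N - j : ℕ) : ℝ) := by exact_mod_cast (show N - j - 1 ≤ N - j by omega)
    _ = 6 * w * M * H' * ((N - j : ℕ) : ℝ) := by ring

/-- **The weight oscillates by `e^{𝒪(w)}` along one window coordinate**: for `|t|, |t'| ≤ M`,
`e^{T_N(B[j ↦ t])} ≤ exp(2Mw(H + 6wMH'(N-j))) · e^{T_N(B[j ↦ t'])}`. [folklore] -/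
theorem exp_duT_update_le (hM : 0 ≤ M) (hw0 : 0 < w) (hw : w ≤ pcW M) {B : ℕ → ℝ}
    (hB : ∀ i, |B i| ≤ M) {h : ℝ → ℝ} (hhd : Differentiable ℝ h) {H H' : ℝ} (hH : ∀ y, |h y| ≤ H)
    (hH' : ∀ y, |deriv h y| ≤ H') {N j : ℕ} (hjN : j < N) (hwin : 5 * π * w * M * ((N - j : ℕ) : ℝ) ≤ 1)
    {t t' : ℝ} (ht : |t| ≤ M) (ht' : |t'| ≤ M) :
    Real.exp (duT w x h (update B j t) N) ≤
      Real.exp (2 * M * (w * (H + 6 * w * M * H' * ((N - j : ℕ) : ℝ)))) * Real.exp (duT w x h (update B j t') N) := by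
  set D : ℝ := w * (H + 6 * w * M * H' * ((N - j : ℕ) : ℝ)) with hD
  set F : ℝ → ℝ := fun s => duT w x h (update B j s) N with hF
  -- derivative of the section at any `|s| ≤ M`, and its bound
  have hderiv : ∀ s ∈ Set.Icc (-M) M, HasDerivAt F (duDT w x h (update B j s) N j) s ∧
      |duDT w x h (update B j s) N j| ≤ D := by
    intro s hs
    have hs' : |s| ≤ M := abs_le.mpr ⟨hs.1, hs.2⟩
    have hB' : ∀ i, |update B j s i| ≤ M := fun i => by
      rcases eq_or_ne i j with rfl | hne
      · rwa [update_self]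
      · rw [update_of_ne hne]; exact hB i
    have h1 := hasDerivAt_duT_update (x := x) hM hw0 hw (update B j s) hB' hhd N j
    simp only [update_idem, update_self] at h1
    exact ⟨h1, abs_duDT_le_of_window hM hw0 hw hB' hH hH' hjN hwin⟩
  have hmvt := (convex_Icc (-M) M).norm_image_sub_le_of_norm_hasDerivWithin_le (f := F)
    (f' := fun s => duDT w x h (update B j s) N j) (C := D)
    (fun s hs => (hderiv s hs).1.hasDerivWithinAt)
    (fun s hs => by rw [Real.norm_eq_abs]; exact (hderiv s hs).2)
    (abs_le.mp ht') (abs_le.mp ht)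
  rw [Real.norm_eq_abs, Real.norm_eq_abs] at hmvt
  have htt : |t - t'| ≤ 2 * M := by
    have h1 := abs_le.mp ht; have h2 := abs_le.mp ht'
    exact abs_le.mpr ⟨by linarith, by linarith⟩
  have hD0 : 0 ≤ D := by
    rw [hD]
    have hH0 : 0 ≤ H := (abs_nonneg _).trans (hH 0)
    have hH'0 : 0 ≤ H' := (abs_nonneg _).trans (hH' 0)
    positivity
  have hdiff : F t - F t' ≤ 2 * M * D := by
    calc F t - F t' ≤ |F t - F t'| := le_abs_self _
      _ ≤ D * |t - t'| := hmvt
      _ ≤ D * (2 * M) := mul_le_mul_of_nonneg_left htt hD0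
      _ = 2 * M * D := by ring
  calc Real.exp (F t) = Real.exp (F t - F t') * Real.exp (F t') := by rw [← Real.exp_add]; ring_nf
    _ ≤ Real.exp (2 * M * D) * Real.exp (F t') :=
        mul_le_mul_of_nonneg_right (Real.exp_le_exp.mpr hdiff) (Real.exp_pos _).le

end Window

/-! ### The good part: `ε → 0` in the regularised integration by parts -/

section Good

variable {τ : ℝ → ℝ} {bm bp : ℝ}

-- keep the unifier from unfolding the trigonometric polynomials and the chain (expensive `whnf`)
attribute [local irreducible] pcP pcPx pcPd ahPhase igDelta

/-- `|χ_L'| ≤ C/L` for a global bound `C` of `smoothTransition'`. [folklore] -/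
theorem abs_duDChi_le {C : ℝ} (hC : ∀ t, |deriv Real.smoothTransition t| ≤ C) {L : ℝ} (hL : 0 < L)
    (s : ℝ) : |duDChi L s| ≤ C / L := by
  unfold duDChi
  rw [abs_div, abs_of_pos hL]
  exact div_le_div_of_nonneg_right (hC _) hL.le

/-- **The good part of the density bound.** In the regime of `integral_core_le` with cutoff level
`L = νm₁`, `(n+1) ≤ 2m₁`, `w√(n+1) ≤ 1`, and with `|g| ≤ A_g` (for dominated convergence):
`|∫ g(X_{n+1}) e^T χ_L(N_{m₁}) dτ^{⊗(n+1)}| ≤ A_G K₁/(w√(n+1))`, `K₁` the constant of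
`core_bound_algebra`. [folklore] -/
theorem good_part_bound (hτ : ReducedLawHyp τ bm bp) (S : SmoothingField τ bm bp)
    {ρB : Measure ℝ} [IsProbabilityMeasure ρB]
    (hρ : ρB = volume.withDensity fun s => ENNReal.ofReal (τ s))
    {w x : ℝ} (hw0 : 0 < w) (hwR : w ≤ pcW (max |bm| |bp| + 1))
    {h G g : ℝ → ℝ} (hh : ContDiff ℝ 1 h) {H : ℝ} (hH : ∀ y, |h y| ≤ H)
    (hG : ∀ y, HasDerivAt G (g y) y) (hg : Continuous g) {Ag : ℝ} (hAg : ∀ y, |g y| ≤ Ag)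
    {AG : ℝ} (hAG : ∀ y, |G y| ≤ AG) {Ξ : ℝ} (hΞ : ∀ b, |deriv S.ξ b| ≤ Ξ)
    {n m₁ : ℕ} (hm₁ : m₁ ≤ n + 1) (hm₁2 : (n + 1 : ℝ) ≤ 2 * m₁) (hm₁0 : 0 < m₁) {ν : ℝ} (hν : 0 < ν)
    (hws : w * Real.sqrt (n + 1) ≤ 1) {Cχ : ℝ} (hCχ0 : 0 ≤ Cχ)
    (hCχ : ∀ t, |deriv Real.smoothTransition t| ≤ Cχ) {CJ CΘ CM CL : ℝ} (hCJ : 0 ≤ CJ) (hCΘ : 0 ≤ CΘ)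
    (hCM : 0 ≤ CM) (hCL : 0 ≤ CL)
    (hJ2 : ∀ i, i ≤ n + 1 → ∫ b, vaJ w x (finExt b) i ^ 2 ∂(Measure.pi fun _ : Fin (n + 1) => ρB) ≤ CJ)
    (hQ : ∫ b, (Real.exp (duT w x h (finExt b) (n + 1)) / vaJ w x (finExt b) (n + 1)) ^ 2
      ∂(Measure.pi fun _ : Fin (n + 1) => ρB) ≤ CΘ)
    (hE : Integrable (fun b : Fin (n + 1) → ℝ => Real.exp (duT w x h (finExt b) (n + 1)))
      (Measure.pi fun _ : Fin (n + 1) => ρB))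
    (hM2 : ∫ b, (∑ i ∈ Finset.range (n + 1), finExt b i * Real.cos (2 * π * ahPhase w x (finExt b) i) *
        (vaJ w x (finExt b) i * vaN w x (finExt b) S.ξ i)) ^ 2 ∂(Measure.pi fun _ : Fin (n + 1) => ρB) ≤
      CM * (n + 1) ^ 3)
    (hM3 : ∫ b, (∑ j ∈ Finset.range (n + 1), deriv h (ahPhase w x (finExt b) j) * finExt b j *
        (vaJ w x (finExt b) j * vaN w x (finExt b) S.ξ j)) ^ 2 ∂(Measure.pi fun _ : Fin (n + 1) => ρB) ≤
      CM * (n + 1) ^ 3)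
    (hLa : ∫ b, (∑ k : Fin (n + 1), vaA w x (finExt b) k * S.ℓ (b k)) ^ 2
      ∂(Measure.pi fun _ : Fin (n + 1) => ρB) ≤ CL * (n + 1) / w ^ 2) :
    |∫ b, g (ahPhase w x (finExt b) (n + 1)) * Real.exp (duT w x h (finExt b) (n + 1)) *
        duChi (ν * m₁) (vaN w x (finExt b) S.ξ m₁) ∂(Measure.pi fun _ : Fin (n + 1) => ρB)| ≤
      AG * (((CL + CΘ) / ν + (1 + 4 * π ^ 2) * (CM + CΘ) / ν +
        (CJ + CΘ) / 2 * (4 * H / ν + 16 * (Cχ + 1) * Ξ / ν ^ 2 + 16 * π * (Cχ + 1) / ν ^ 2 +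
          112 * π ^ 3 * (max |bm| |bp|) ^ 2 / ν + 12 * π / ν)) / (w * Real.sqrt (n + 1))) := by
  set μ := (Measure.pi fun _ : Fin (n + 1) => ρB) with hμ
  set bstar : ℝ := max |bm| |bp| with hbstar
  set R : ℝ := bstar + 1 with hR
  have hbstar0 : 0 ≤ bstar := le_max_of_le_left (abs_nonneg _)
  have hR0 : 0 < R := by rw [hR]; linarith
  have hwb : w ≤ pcW bstar := hwR.trans (pcW_antitone hbstar0 (by rw [hR]; linarith))
  obtain ⟨hw2, -, -⟩ := pc_small hbstar0 hw0.le hwb (show |(0:ℝ)| ≤ bstar by rw [abs_zero]; exact hbstar0)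
  have hwπ : π * w / 2 < 1 := by linarith
  set L : ℝ := ν * m₁ with hLdef
  have hm₁r : (0 : ℝ) < m₁ := by exact_mod_cast hm₁0
  have hL : 0 < L := by rw [hLdef]; positivity
  have hAG0 : 0 ≤ AG := (abs_nonneg _).trans (hAG 0)
  have hAg0 : 0 ≤ Ag := (abs_nonneg _).trans (hAg 0)
  have hH0 : 0 ≤ H := (abs_nonneg _).trans (hH 0)
  have hΞ0 : 0 ≤ Ξ := (abs_nonneg _).trans (hΞ 0)
  set s : ℝ := Real.sqrt (n + 1) with hs
  have hn1 : (0 : ℝ) < n + 1 := by positivity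
  have hs0 : 0 < s := Real.sqrt_pos.mpr hn1
  have hss : s ^ 2 = n + 1 := Real.sq_sqrt hn1.le
  have hs1 : 1 ≤ s := by
    rw [hs]; exact Real.one_le_sqrt.mpr (by linarith [(Nat.cast_nonneg n : (0:ℝ) ≤ n)])
  -- the per-`L` cutoff data
  have hCχL : ∀ t, |duDChi L t| ≤ Cχ / L := fun t => abs_duDChi_le hCχ hL t
  obtain ⟨-, -, -, hsupp⟩ := duDChi_bounds hL
  -- the bound for each `ε > 0`
  set K₁ : ℝ := ((CL + CΘ) / ν + (1 + 4 * π ^ 2) * (CM + CΘ) / ν +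
        (CJ + CΘ) / 2 * (4 * H / ν + 16 * (Cχ + 1) * Ξ / ν ^ 2 + 16 * π * (Cχ + 1) / ν ^ 2 +
          112 * π ^ 3 * bstar ^ 2 / ν + 12 * π / ν)) with hK₁
  have hεbound : ∀ ε : ℝ, 0 < ε →
      |∫ b, g (ahPhase w x (finExt b) (n + 1)) * Real.exp (duT w x h (finExt b) (n + 1)) *
        duChi L (vaN w x (finExt b) S.ξ m₁) *
        (duU w x (finExt b) S.ξ (n + 1) * (duU w x (finExt b) S.ξ (n + 1) + ε)⁻¹) ∂μ| ≤ AG * (K₁ / (w * s)) := by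
    intro ε hε
    have hcore := integral_core_le hτ S hρ hw0 hwR hh hH hG hg hAG hΞ hm₁ hL hε hCχL hsupp hJ2 hQ hM2 hM3 hLa
      (x := x)
    refine hcore.trans ?_
    have halg := core_bound_algebra (AG := AG) (CL := CL) (CΘ := CΘ) (CM := CM) (CJ := CJ) (H := H) (Ξ := Ξ)
      (Cχ := Cχ) (bstar := bstar) hw0 hs1 hws hss.symm hν hL
      (by rw [hLdef]; have := mul_le_mul_of_nonneg_left hm₁2 hν.le; linarith)
      (le_igC hw0.le hwπ) (igC_le hw0.le hw2) hAG0 hCL hCΘ hCM hCJ hH0 hΞ0 hCχ0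
    exact halg
  -- `ε → 0` by dominated convergence
  set f : (Fin (n + 1) → ℝ) → ℝ := fun b => g (ahPhase w x (finExt b) (n + 1)) *
    Real.exp (duT w x h (finExt b) (n + 1)) * duChi L (vaN w x (finExt b) S.ξ m₁) with hf
  set F : ℕ → (Fin (n + 1) → ℝ) → ℝ := fun k b => f b *
    (duU w x (finExt b) S.ξ (n + 1) * (duU w x (finExt b) S.ξ (n + 1) + 1 / ((k : ℝ) + 1))⁻¹) with hFdef
  have hεk : ∀ k : ℕ, (0 : ℝ) < 1 / ((k : ℝ) + 1) := fun k => Nat.one_div_pos_of_nat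
  -- continuity / measurability
  set U : Set (Fin (n + 1) → ℝ) := Set.pi Set.univ fun _ : Fin (n + 1) => Set.Ioo (-R) R with hU
  have hhc : Continuous h := hh.continuous
  have hξc : Continuous S.ξ := S.ξ_contDiff.continuous
  have hfc : ContinuousOn f U :=
    (((hg.comp_continuousOn (continuousOn_ahPhase_pi hR0 hw0.le hwR x (n + 1))).mul
      (Real.continuous_exp.comp_continuousOn (continuousOn_duT_pi hR0 hw0.le hwR x hhc (n + 1)))).mul
      ((continuous_duChi L).comp_continuousOn (continuousOn_vaN_pi hR0 hw0.le hwR x hξc m₁)))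
  have hUc := continuousOn_duU_pi (n := n + 1) hR0 hw0.le hwR x hξc (n + 1)
  have hFc : ∀ k, ContinuousOn (F k) U := fun k =>
    hfc.mul (hUc.mul ((hUc.add continuousOn_const).inv₀ fun b _ => (duU_add_pos w x _ S.ξ_nonneg (hεk k) _).ne'))
  have hFm : ∀ k, AEStronglyMeasurable (F k) μ := fun k => (integrable_pi_of_continuousOn hτ hρ (hFc k)).2.aestronglyMeasurable
  -- domination by `A_g e^T`
  have hbound : ∀ k, ∀ᵐ b ∂μ, ‖F k b‖ ≤ Ag * Real.exp (duT w x h (finExt b) (n + 1)) := by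
    intro k
    refine ae_of_all _ fun b => ?_
    have hE0 := Real.exp_pos (duT w x h (finExt b) (n + 1))
    have hχ := duChi_mem L (vaN w x (finExt b) S.ξ m₁)
    have hU0 : 0 ≤ duU w x (finExt b) S.ξ (n + 1) := duU_nonneg w x _ S.ξ_nonneg _
    have hUε := duU_add_pos w x (finExt b) S.ξ_nonneg (hεk k) (n + 1)
    have hq : duU w x (finExt b) S.ξ (n + 1) * (duU w x (finExt b) S.ξ (n + 1) + 1 / ((k : ℝ) + 1))⁻¹ ≤ 1 := by
      rw [← div_eq_mul_inv, div_le_one hUε]; linarith [hεk k]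
    have hq0 : 0 ≤ duU w x (finExt b) S.ξ (n + 1) * (duU w x (finExt b) S.ξ (n + 1) + 1 / ((k : ℝ) + 1))⁻¹ :=
      mul_nonneg hU0 (inv_pos.mpr hUε).le
    rw [Real.norm_eq_abs]
    simp only [hFdef, hf]
    rw [abs_mul, abs_mul, abs_mul, abs_of_pos hE0, abs_of_nonneg hχ.1, abs_of_nonneg hq0]
    calc |g (ahPhase w x (finExt b) (n + 1))| * Real.exp (duT w x h (finExt b) (n + 1)) *
          duChi L (vaN w x (finExt b) S.ξ m₁) *
          (duU w x (finExt b) S.ξ (n + 1) * (duU w x (finExt b) S.ξ (n + 1) + 1 / ((k : ℝ) + 1))⁻¹)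
        ≤ Ag * Real.exp (duT w x h (finExt b) (n + 1)) * 1 * 1 := by
          refine mul_le_mul (mul_le_mul (mul_le_mul_of_nonneg_right (hAg _) hE0.le) hχ.2 hχ.1
            (by positivity)) hq hq0 (by positivity)
      _ = Ag * Real.exp (duT w x h (finExt b) (n + 1)) := by ring
  -- pointwise limit
  have hlim : ∀ᵐ b ∂μ, Tendsto (fun k => F k b) atTop (𝓝 (f b)) := by
    refine ae_of_all _ fun b => ?_
    simp only [hFdef]
    have hχ := duChi_mem L (vaN w x (finExt b) S.ξ m₁)
    rcases hχ.1.eq_or_lt with h0 | hpos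
    · have hf0 : f b = 0 := by simp only [hf, ← h0, mul_zero]
      rw [hf0]; simp only [zero_mul]; exact tendsto_const_nhds
    · obtain ⟨-, hU0, -⟩ := duU_ge_of_lt (finExt b) S.ξ_nonneg hm₁ hL (lt_of_duChi_pos hL hpos) (w := w) (x := x)
      have ht : Tendsto (fun k : ℕ => duU w x (finExt b) S.ξ (n + 1) *
          (duU w x (finExt b) S.ξ (n + 1) + 1 / ((k : ℝ) + 1))⁻¹) atTop (𝓝 1) := by
        have h1 : Tendsto (fun k : ℕ => duU w x (finExt b) S.ξ (n + 1) + 1 / ((k : ℝ) + 1)) atTop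
            (𝓝 (duU w x (finExt b) S.ξ (n + 1) + 0)) :=
          tendsto_const_nhds.add tendsto_one_div_add_atTop_nhds_zero_nat
        rw [add_zero] at h1
        have h2 := (h1.inv₀ hU0.ne').const_mul (duU w x (finExt b) S.ξ (n + 1))
        rwa [mul_inv_cancel₀ hU0.ne'] at h2
      have := ht.const_mul (f b)
      rwa [mul_one] at this
  have hDCT := tendsto_integral_of_dominated_convergence (fun b => Ag * Real.exp (duT w x h (finExt b) (n + 1)))
    hFm (hE.const_mul Ag) hbound hlim
  -- pass to the limit in the bound
  have habs := (continuous_abs.tendsto _).comp hDCT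
  refine le_of_tendsto' habs fun k => ?_
  have := hεbound (1 / ((k : ℝ) + 1)) (hεk k)
  simp only [Function.comp_apply, hFdef, hf]
  simpa [mul_assoc] using this

end Good

/-! ### The bad part: `{N_{m₁} < 2νm₁}` has exponentially small probability -/

section Bad

variable {τ : ℝ → ℝ} {bm bp : ℝ}

/-- `b ↦ u_k(b)` is measurable. [folklore] -/
theorem measurable_vaU_pi (w x : ℝ) {m : ℕ} (k : ℕ) :
    Measurable fun b : Fin m → ℝ => vaU w x (finExt b) k := by
  unfold vaU
  exact measurable_const.sub (Real.measurable_cos.comp (measurable_const.mul (measurable_ahPhase_pi w x k)))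

/-- `b ↦ N_j(b)` is measurable (`ξ` measurable). [folklore] -/
theorem measurable_vaN_pi (w x : ℝ) {m : ℕ} {ξ : ℝ → ℝ} (hξ : Measurable ξ) (j : ℕ) :
    Measurable fun b : Fin m → ℝ => vaN w x (finExt b) ξ j := by
  unfold vaN
  refine Finset.measurable_sum _ fun k _ => ?_
  exact (hξ.comp (measurable_finExt k)).mul (measurable_vaU_pi w x k)

/-- `b ↦ T_j(b)` is measurable (`h` measurable). [folklore] -/
theorem measurable_duT_pi (w x : ℝ) {m : ℕ} {h : ℝ → ℝ} (hh : Measurable h) (j : ℕ) :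
    Measurable fun b : Fin m → ℝ => duT w x h (finExt b) j := by
  unfold duT
  refine measurable_const.mul (Finset.measurable_sum _ fun i _ => ?_)
  exact (hh.comp (measurable_ahPhase_pi w x i)).mul (measurable_finExt i)

/-- **AM–GM on an event**: `1_A e ≤ (t e² + 1_A/t)/2` for `t > 0`. [folklore] -/
theorem indicator_mul_le_amgm {α : Type*} (A : Set α) {t : ℝ} (ht : 0 < t) (e : α → ℝ) (a : α) :
    A.indicator e a ≤ (t * e a ^ 2 + A.indicator (fun _ => (1 : ℝ)) a / t) / 2 := by
  by_cases ha : a ∈ A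
  · rw [Set.indicator_of_mem ha, Set.indicator_of_mem ha]
    have h : 0 ≤ (t * e a - 1) ^ 2 / t := by positivity
    have he : (t * e a - 1) ^ 2 / t = t * e a ^ 2 + 1 / t - 2 * e a := by field_simp; ring
    linarith [he ▸ h]
  · rw [Set.indicator_of_notMem ha, Set.indicator_of_notMem ha]
    positivity

/-- **The bad part.** With `L = νm₁`, the cutoff `1 - χ_L(N_{m₁})` lives on `{N_{m₁} < 2νm₁}`; by the
weighted crude density bound (the weight `e^T 1_{bad}` oscillates by at most a factor `2` along
each window coordinate, `hosc`), the tail `ℙ(bad) ≤ e^{-cm₁}` and `∫e^{2T} ≤ C_Θ`: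
`∫ φ(X_{n+1}) e^T (1 - χ) ≤ 2 C_cr (C_Θ + 1) (∫_𝕋φ) e^{-cm₁/2}/w`. [folklore] -/
theorem bad_part_bound (S : SmoothingField τ bm bp) {ρB : Measure ℝ} [IsProbabilityMeasure ρB]
    {w x : ℝ} (hw0 : 0 < w) {h : ℝ → ℝ} (hhm : Measurable h)
    {φ : ℝ → ℝ} (hφ : Continuous φ) (hφper : Function.Periodic φ 1) (hφ0 : ∀ y, 0 ≤ φ y)
    {n m₁ : ℕ} {ν : ℝ} (hν : 0 < ν) (hm₁0 : 0 < m₁) {CΘ c Ccr : ℝ} (hCΘ : 0 ≤ CΘ) (hCcr : 0 ≤ Ccr)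
    (hE2 : Integrable (fun b : Fin (n + 1) → ℝ => Real.exp (duT w x h (finExt b) (n + 1)) ^ 2)
        (Measure.pi fun _ : Fin (n + 1) => ρB) ∧
      ∫ b, Real.exp (duT w x h (finExt b) (n + 1)) ^ 2 ∂(Measure.pi fun _ : Fin (n + 1) => ρB) ≤ CΘ)
    (hEφ : Integrable (fun b : Fin (n + 1) → ℝ => φ (ahPhase w x (finExt b) (n + 1)) *
        Real.exp (duT w x h (finExt b) (n + 1))) (Measure.pi fun _ : Fin (n + 1) => ρB))
    (htail : (Measure.pi fun _ : Fin (n + 1) => ρB) {b | vaN w x (finExt b) S.ξ m₁ < 2 * ν * m₁} ≤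
      ENNReal.ofReal (Real.exp (-(c * m₁))))
    (hcrude : ∀ g : ℝ → ℝ≥0∞, Measurable g → Function.Periodic g 1 →
      ∀ F : (Fin (n + 1) → ℝ) → ℝ≥0∞, Measurable F → ∀ A : ℝ≥0∞,
        (∀ j : Fin (n + 1), m₁ ≤ j.val → ∀ b : Fin (n + 1) → ℝ, (∀ i, bm ≤ b i ∧ b i ≤ bp) →
          ∀ t ∈ Set.Icc bm bp, ∀ t' ∈ Set.Icc bm bp,
            F (Function.update b j t) ≤ A * F (Function.update b j t')) →
        ∫⁻ b, F b * g (ahPhase w x (finExt b) (n + 1)) ∂(Measure.pi fun _ : Fin (n + 1) => ρB) ≤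
          A ^ 2 * ENNReal.ofReal (Ccr / w) * (∫⁻ y in Set.Ioc 0 1, g y) *
            ∫⁻ b, F b ∂(Measure.pi fun _ : Fin (n + 1) => ρB))
    (hosc : ∀ j : Fin (n + 1), m₁ ≤ j.val → ∀ b : Fin (n + 1) → ℝ, (∀ i, bm ≤ b i ∧ b i ≤ bp) →
      ∀ t ∈ Set.Icc bm bp, ∀ t' ∈ Set.Icc bm bp,
        Real.exp (duT w x h (finExt (Function.update b j t)) (n + 1)) ≤
          2 * Real.exp (duT w x h (finExt (Function.update b j t')) (n + 1))) :
    ∫ b, φ (ahPhase w x (finExt b) (n + 1)) * Real.exp (duT w x h (finExt b) (n + 1)) *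
        (1 - duChi (ν * m₁) (vaN w x (finExt b) S.ξ m₁)) ∂(Measure.pi fun _ : Fin (n + 1) => ρB) ≤
      2 * Ccr * (CΘ + 1) * (∫ y in Set.Ico (0 : ℝ) 1, φ y) * Real.exp (-(c * m₁ / 2)) / w := by
  set μ := (Measure.pi fun _ : Fin (n + 1) => ρB) with hμ
  set L : ℝ := ν * m₁ with hL
  have hm₁r : (0 : ℝ) < m₁ := by exact_mod_cast hm₁0
  have hL0 : 0 < L := by rw [hL]; positivity
  set E : (Fin (n + 1) → ℝ) → ℝ := fun b => Real.exp (duT w x h (finExt b) (n + 1)) with hEdef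
  set bad : Set (Fin (n + 1) → ℝ) := {b | vaN w x (finExt b) S.ξ m₁ < 2 * ν * m₁} with hbad
  have hEm : Measurable E := Real.measurable_exp.comp (measurable_duT_pi w x hhm (n + 1))
  have hNm : Measurable fun b : Fin (n + 1) → ℝ => vaN w x (finExt b) S.ξ m₁ := measurable_vaN_pi w x S.ξ_measurable m₁
  have hbadm : MeasurableSet bad := measurableSet_lt hNm measurable_const
  have hXm : Measurable fun b : Fin (n + 1) → ℝ => ahPhase w x (finExt b) (n + 1) := measurable_ahPhase_pi w x (n + 1)
  set μ₀ : ℝ := ∫ y in Set.Ico (0 : ℝ) 1, φ y with hμ₀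
  have hμ₀0 : 0 ≤ μ₀ := setIntegral_nonneg measurableSet_Ico fun y _ => hφ0 y
  -- Step 1: `φ E (1 - χ) ≤ 1_bad φ E`
  have hstep1 : ∀ b, φ (ahPhase w x (finExt b) (n + 1)) * E b * (1 - duChi L (vaN w x (finExt b) S.ξ m₁)) ≤
      bad.indicator (fun b => φ (ahPhase w x (finExt b) (n + 1)) * E b) b := by
    intro b
    have hφE : 0 ≤ φ (ahPhase w x (finExt b) (n + 1)) * E b := mul_nonneg (hφ0 _) (Real.exp_pos _).le
    have hχ := duChi_mem L (vaN w x (finExt b) S.ξ m₁)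
    by_cases hb : b ∈ bad
    · rw [Set.indicator_of_mem hb]
      calc _ ≤ φ (ahPhase w x (finExt b) (n + 1)) * E b * 1 :=
            mul_le_mul_of_nonneg_left (by linarith [hχ.1]) hφE
        _ = _ := mul_one _
    · rw [Set.indicator_of_notMem hb]
      have hge : 2 * L ≤ vaN w x (finExt b) S.ξ m₁ := by
        simp only [hbad, Set.mem_setOf_eq, not_lt] at hb; rw [hL]; linarith
      rw [duChi_eq_one hL0 hge, sub_self, mul_zero]
  -- Step 2: the weighted crude bound with `F = 1_bad e^T`, `g = φ`
  set F : (Fin (n + 1) → ℝ) → ℝ≥0∞ := fun b => bad.indicator (fun b => ENNReal.ofReal (E b)) b with hFdef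
  have hFm : Measurable F := (ENNReal.measurable_ofReal.comp hEm).indicator hbadm
  set g : ℝ → ℝ≥0∞ := fun y => ENNReal.ofReal (φ y) with hgdef
  have hgm : Measurable g := ENNReal.measurable_ofReal.comp hφ.measurable
  have hgper : Function.Periodic g 1 := fun y => by simp only [hgdef, hφper y]
  have hbad_upd : ∀ (j : Fin (n + 1)), m₁ ≤ j.val → ∀ (b : Fin (n + 1) → ℝ) (t : ℝ),
      (Function.update b j t ∈ bad ↔ b ∈ bad) := by
    intro j hj b t
    simp only [hbad, Set.mem_setOf_eq, finExt_update]
    rw [vaN_update_of_le w x S.ξ _ hj]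
  have hF2 : ∀ j : Fin (n + 1), m₁ ≤ j.val → ∀ b : Fin (n + 1) → ℝ, (∀ i, bm ≤ b i ∧ b i ≤ bp) →
      ∀ t ∈ Set.Icc bm bp, ∀ t' ∈ Set.Icc bm bp,
        F (Function.update b j t) ≤ (2 : ℝ≥0∞) * F (Function.update b j t') := by
    intro j hj b hb t ht t' ht'
    simp only [hFdef]
    by_cases hbb : b ∈ bad
    · rw [Set.indicator_of_mem ((hbad_upd j hj b t).mpr hbb), Set.indicator_of_mem ((hbad_upd j hj b t').mpr hbb),
        show (2 : ℝ≥0∞) = ENNReal.ofReal 2 by norm_num, ← ENNReal.ofReal_mul (by norm_num)]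
      exact ENNReal.ofReal_le_ofReal (hosc j hj b hb t ht t' ht')
    · rw [Set.indicator_of_notMem (fun h' => hbb ((hbad_upd j hj b t).mp h'))]
      exact zero_le
  have hcr := hcrude g hgm hgper F hFm 2 hF2
  -- Step 3: evaluate the three `lintegral`s
  have hg1 : ∫⁻ y in Set.Ioc 0 1, g y = ENNReal.ofReal μ₀ := by
    rw [hμ₀, integral_Ico_eq_integral_Ioc,
      ofReal_integral_eq_lintegral_ofReal (hφ.integrableOn_Ioc) (ae_of_all _ fun y => hφ0 y)]
  have hFint : ∫⁻ b, F b ∂μ ≤ ENNReal.ofReal (Real.exp (-(c * m₁ / 2)) * (CΘ + 1) / 2) := by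
    set t : ℝ := Real.exp (-(c * m₁ / 2)) with ht
    have ht0 : 0 < t := Real.exp_pos _
    have hFeq : ∀ b, F b = ENNReal.ofReal (bad.indicator E b) := fun b => by
      simp only [hFdef]
      by_cases hb : b ∈ bad
      · rw [Set.indicator_of_mem hb, Set.indicator_of_mem hb]
      · rw [Set.indicator_of_notMem hb, Set.indicator_of_notMem hb, ENNReal.ofReal_zero]
    have hmaj : Integrable (fun b => E b ^ 2 + 1) μ := hE2.1.add (integrable_const 1)
    have hind_int : Integrable (bad.indicator E) μ := by
      refine hmaj.mono' (hEm.indicator hbadm).aestronglyMeasurable (ae_of_all _ fun b => ?_)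
      rw [Real.norm_eq_abs]
      have hE0 : 0 < E b := Real.exp_pos _
      by_cases hb : b ∈ bad
      · rw [Set.indicator_of_mem hb, abs_of_pos hE0]
        nlinarith [sq_nonneg (E b - 1)]
      · rw [Set.indicator_of_notMem hb, abs_zero]; nlinarith [sq_nonneg (E b)]
    have hmaj2 : Integrable (fun b => (t * E b ^ 2 + bad.indicator (fun _ => (1 : ℝ)) b / t) / 2) μ :=
      ((hE2.1.const_mul t).add (((integrable_const (1 : ℝ)).indicator hbadm).div_const t)).div_const 2
    calc ∫⁻ b, F b ∂μ = ∫⁻ b, ENNReal.ofReal (bad.indicator E b) ∂μ := lintegral_congr hFeq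
      _ = ENNReal.ofReal (∫ b, bad.indicator E b ∂μ) := by
          rw [ofReal_integral_eq_lintegral_ofReal hind_int (ae_of_all _ fun b => ?_)]
          exact Set.indicator_nonneg (fun b _ => (Real.exp_pos _).le) _
      _ ≤ ENNReal.ofReal (∫ b, (t * E b ^ 2 + bad.indicator (fun _ => (1 : ℝ)) b / t) / 2 ∂μ) := by
          refine ENNReal.ofReal_le_ofReal (integral_mono_of_nonneg ?_ hmaj2
            (ae_of_all _ fun b => indicator_mul_le_amgm bad ht0 E b))
          exact ae_of_all _ fun b => Set.indicator_nonneg (fun b _ => (Real.exp_pos _).le) _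
      _ = ENNReal.ofReal ((t * ∫ b, E b ^ 2 ∂μ + μ.real bad / t) / 2) := by
          congr 1
          rw [integral_div, integral_add (hE2.1.const_mul t) (((integrable_const (1:ℝ)).indicator hbadm).div_const t),
            integral_const_mul, integral_div, integral_indicator_const _ hbadm, smul_eq_mul, mul_one]
      _ ≤ ENNReal.ofReal ((t * CΘ + Real.exp (-(c * m₁)) / t) / 2) := by
          refine ENNReal.ofReal_le_ofReal ?_
          have hP : μ.real bad ≤ Real.exp (-(c * m₁)) := by
            rw [measureReal_def]
            exact ENNReal.toReal_le_of_le_ofReal (Real.exp_pos _).le htail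
          gcongr
          exact hE2.2
      _ = ENNReal.ofReal (t * (CΘ + 1) / 2) := by
          congr 1
          have : Real.exp (-(c * m₁)) / t = t := by
            rw [ht, div_eq_iff (Real.exp_pos _).ne', ← Real.exp_add]; ring_nf
          rw [this]; ring
  -- Step 4: assemble
  have hlhs : ∫ b, bad.indicator (fun b => φ (ahPhase w x (finExt b) (n + 1)) * E b) b ∂μ =
      (∫⁻ b, F b * g (ahPhase w x (finExt b) (n + 1)) ∂μ).toReal := by
    have hnn : ∀ b, 0 ≤ bad.indicator (fun b => φ (ahPhase w x (finExt b) (n + 1)) * E b) b := fun b =>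
      Set.indicator_nonneg (fun b _ => mul_nonneg (hφ0 _) (Real.exp_pos _).le) _
    rw [integral_eq_lintegral_of_nonneg_ae (ae_of_all _ hnn)
      ((hφ.measurable.comp hXm).mul hEm |>.indicator hbadm).aestronglyMeasurable]
    congr 1
    refine lintegral_congr fun b => ?_
    simp only [hFdef, hgdef]
    by_cases hb : b ∈ bad
    · rw [Set.indicator_of_mem hb, Set.indicator_of_mem hb, ← ENNReal.ofReal_mul (Real.exp_pos _).le, mul_comm]
    · rw [Set.indicator_of_notMem hb, Set.indicator_of_notMem hb, ENNReal.ofReal_zero, zero_mul]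
  calc ∫ b, φ (ahPhase w x (finExt b) (n + 1)) * E b * (1 - duChi L (vaN w x (finExt b) S.ξ m₁)) ∂μ
      ≤ ∫ b, bad.indicator (fun b => φ (ahPhase w x (finExt b) (n + 1)) * E b) b ∂μ := by
        refine integral_mono_of_nonneg (ae_of_all _ fun b => ?_) (hEφ.indicator hbadm) (ae_of_all _ hstep1)
        have hχ := duChi_mem L (vaN w x (finExt b) S.ξ m₁)
        exact mul_nonneg (mul_nonneg (hφ0 _) (Real.exp_pos _).le) (by linarith [hχ.2])
    _ = (∫⁻ b, F b * g (ahPhase w x (finExt b) (n + 1)) ∂μ).toReal := hlhs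
    _ ≤ ((2 : ℝ≥0∞) ^ 2 * ENNReal.ofReal (Ccr / w) * ENNReal.ofReal μ₀ *
          ENNReal.ofReal (Real.exp (-(c * m₁ / 2)) * (CΘ + 1) / 2)).toReal := by
        refine ENNReal.toReal_mono (by finiteness) ?_
        refine hcr.trans ?_
        rw [hg1]
        exact mul_le_mul' le_rfl hFint
    _ = 2 * Ccr * (CΘ + 1) * μ₀ * Real.exp (-(c * m₁ / 2)) / w := by
        rw [show (2 : ℝ≥0∞) ^ 2 = ENNReal.ofReal 4 by norm_num, ← ENNReal.ofReal_mul (by norm_num),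
          ← ENNReal.ofReal_mul (by positivity), ← ENNReal.ofReal_mul (by positivity),
          ENNReal.toReal_ofReal (by positivity)]
        field_simp
        ring

end Bad

/-! ### Assembly -/

section Assembly

variable {τ : ℝ → ℝ} {bm bp : ℝ}

-- keep the unifier from unfolding the trigonometric polynomials and the chain (expensive `whnf`)
attribute [local irreducible] pcP pcPx pcPd ahPhase igDelta

/-- A continuous `1`-periodic function is bounded. [folklore] -/
theorem exists_bound_of_periodic {f : ℝ → ℝ} (hf : Continuous f) (hper : Function.Periodic f 1) :
    ∃ C : ℝ, 0 ≤ C ∧ ∀ y, |f y| ≤ C := by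
  obtain ⟨C, hC⟩ := isCompact_Icc.exists_bound_of_continuousOn (s := Set.Icc (0 : ℝ) 1) hf.continuousOn
  refine ⟨max C 0, le_max_right _ _, fun y => ?_⟩
  have hred : f y = f (Int.fract y) := by
    rw [Int.fract, show (y - ⌊y⌋ : ℝ) = y - (⌊y⌋ : ℤ) * (1 : ℝ) by ring, hper.sub_int_mul_eq]
  rw [hred]
  have hmem : Int.fract y ∈ Set.Icc (0 : ℝ) 1 := ⟨Int.fract_nonneg y, (Int.fract_lt_one y).le⟩
  exact ((Real.norm_eq_abs _).symm.le.trans (hC _ hmem)).trans (le_max_left _ _)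

set_option maxHeartbeats 1600000 in
/-- **Prop. 5.1, upper bound (5.1), for continuous test functions** (integration-by-parts proof):
for `κ > 0` and `h ∈ C¹(𝕋)` there are `K, w₀ > 0` such that for `0 < w ≤ w₀`, every continuous
`1`-periodic `u ≥ 0`, every start `x` and every `n` with `wn ≥ κ`, `w²n ≤ 1`:
`𝔼[e^{w∑_{k<n} h(X_k)B_k} u(X_n)] ≤ (K/(w√n)) ∫_{[0,1)} u` (and the integrand is integrable).
[cite: AjankiHuveneers2011, Prop. 5.1 eq. (5.1)] -/
theorem density_upper_continuous (hτ : ReducedLawHyp τ bm bp) (ρB : Measure ℝ) [IsProbabilityMeasure ρB]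
    (hρ : ρB = volume.withDensity fun s => ENNReal.ofReal (τ s)) {κ : ℝ} (hκ : 0 < κ)
    {h : ℝ → ℝ} (hper : Function.Periodic h 1) (hh : ContDiff ℝ 1 h) :
    ∃ K w₀ : ℝ, 0 < K ∧ 0 < w₀ ∧ ∀ w ∈ Set.Ioc 0 w₀,
      ∀ u : ℝ → ℝ, Continuous u → Function.Periodic u 1 → (∀ y, 0 ≤ u y) → ∀ x : ℝ, ∀ n : ℕ,
        κ ≤ w * n → w ^ 2 * n ≤ 1 →
          Integrable (fun B : Fin n → ℝ =>
              Real.exp (w * ∑ k ∈ Finset.range n, h (ahPhase w x (finExt B) k) * finExt B k) *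
                u (ahPhase w x (finExt B) n)) (Measure.pi fun _ : Fin n => ρB) ∧
          ∫ B, Real.exp (w * ∑ k ∈ Finset.range n, h (ahPhase w x (finExt B) k) * finExt B k) *
              u (ahPhase w x (finExt B) n) ∂(Measure.pi fun _ : Fin n => ρB) ≤
            K / (w * Real.sqrt n) * ∫ y in Set.Ico 0 1, u y := by
  -- constants
  set bstar : ℝ := max |bm| |bp| with hbstar
  set R : ℝ := bstar + 1 with hR
  have hbstar0 : 0 ≤ bstar := le_max_of_le_left (abs_nonneg _)
  have hR0 : 0 < R := by rw [hR]; linarith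
  have hhc : Continuous h := hh.continuous
  have hhd : Differentiable ℝ h := hh.differentiable one_ne_zero
  have hhm : Measurable h := hhc.measurable
  have hh'c : Continuous (deriv h) := hh.continuous_deriv le_rfl
  have hper' : Function.Periodic (deriv h) 1 := by
    intro y
    have hfun : (fun z => h (z + 1)) = h := funext hper
    rw [← deriv_comp_add_const, hfun]
  obtain ⟨H, hH0, hH⟩ := exists_bound_of_periodic hhc hper
  obtain ⟨H', hH'0, hH'⟩ := exists_bound_of_periodic hh'c hper'
  set S := smoothingField hτ with hSdef
  obtain ⟨Ξ, hΞ⟩ := S.ξ_deriv_bound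
  have hΞ0 : 0 ≤ Ξ := (abs_nonneg _).trans (hΞ 0)
  obtain ⟨CJ, CΘ, hCJ0, hCΘ0, hmom⟩ := moments_J_Q hτ hρ hhm hH
  obtain ⟨-, Cℓ, hCℓ⟩ := integral_ell_rhoB hτ S hρ
  have hCℓ0 : 0 ≤ Cℓ := le_trans (integral_nonneg fun t => sq_nonneg _) hCℓ
  obtain ⟨Cχ, hCχ0, hCχ⟩ := Literature.Analysis.Calculus.exists_bound_deriv_smoothTransition
  obtain ⟨wt, hwt, ν, hν, ct, hct, htail⟩ := measure_vaN_lt_le hτ S hρ (half_pos hκ)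
  set κ' : ℝ := min (κ / 8) (1 / (10 * π * bstar + 1)) with hκ'
  have hκ'0 : 0 < κ' := by rw [hκ']; exact lt_min (by positivity) (by positivity)
  have hκ'1 : κ' ≤ κ / 8 := min_le_left _ _
  have hκ'small : 10 * π * max |bm| |bp| * κ' ≤ 1 := by
    rw [← hbstar]
    have h1 : κ' ≤ 1 / (10 * π * bstar + 1) := min_le_right _ _
    have h2 : 0 < 10 * π * bstar + 1 := by positivity
    calc 10 * π * bstar * κ' ≤ 10 * π * bstar * (1 / (10 * π * bstar + 1)) :=
          mul_le_mul_of_nonneg_left h1 (by positivity)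
      _ ≤ 1 := by rw [mul_one_div, div_le_one h2]; linarith
  obtain ⟨wc, hwc, Ccr, hCcr0, hcrude⟩ := crude_density_bound_weighted hτ ρB hρ hκ'0 hκ'small
  set CA : ℝ := 2 * bstar * (H + 12 * bstar * H' * κ') with hCA
  have hCA0 : 0 ≤ CA := by rw [hCA]; positivity
  have hlog2 : 0 < Real.log 2 := Real.log_pos one_lt_two
  set w₀ : ℝ := min (min (min (pcW R) wt) (min wc κ')) (min (min (3 * κ / 8) (Real.log 2 / (CA + 1))) 1) with hw₀
  have hw₀0 : 0 < w₀ := by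
    rw [hw₀]
    refine lt_min (lt_min (lt_min (pcW_pos hR0.le) hwt) (lt_min hwc hκ'0)) (lt_min (lt_min (by positivity) ?_) one_pos)
    positivity
  set CM : ℝ := 4 * bstar ^ 2 * CJ * (1 + H' ^ 2) with hCM
  set CL : ℝ := 4 * Cℓ * CJ with hCL
  have hCM0 : 0 ≤ CM := by rw [hCM]; positivity
  have hCL0 : 0 ≤ CL := by rw [hCL]; positivity
  set K₁ : ℝ := (CL + CΘ) / ν + (1 + 4 * π ^ 2) * (CM + CΘ) / ν +
      (CJ + CΘ) / 2 * (4 * H / ν + 16 * (Cχ + 1) * Ξ / ν ^ 2 + 16 * π * (Cχ + 1) / ν ^ 2 +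
        112 * π ^ 3 * bstar ^ 2 / ν + 12 * π / ν) with hK₁
  have hK₁0 : 0 ≤ K₁ := by rw [hK₁]; positivity
  set K : ℝ := CΘ + 2 * K₁ + 8 * Ccr * (CΘ + 1) / ct + 1 with hK
  have hK0 : 0 < K := by rw [hK]; positivity
  refine ⟨K, w₀, hK0, hw₀0, ?_⟩
  -- the claim
  intro w hw u huc huper hu0 x n hκn hwn
  obtain ⟨hw0, hwle⟩ := hw
  have hA : w₀ ≤ min (min (pcW R) wt) (min wc κ') := min_le_left _ _
  have hB : w₀ ≤ min (min (3 * κ / 8) (Real.log 2 / (CA + 1))) 1 := min_le_right _ _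
  have hwR : w ≤ pcW R := hwle.trans (hA.trans ((min_le_left _ _).trans (min_le_left _ _)))
  have hwt' : w ≤ wt := hwle.trans (hA.trans ((min_le_left _ _).trans (min_le_right _ _)))
  have hwc' : w ≤ wc := hwle.trans (hA.trans ((min_le_right _ _).trans (min_le_left _ _)))
  have hwκ' : w ≤ κ' := hwle.trans (hA.trans ((min_le_right _ _).trans (min_le_right _ _)))
  have hw38 : w ≤ 3 * κ / 8 := hwle.trans (hB.trans ((min_le_left _ _).trans (min_le_left _ _)))
  have hwlog : w ≤ Real.log 2 / (CA + 1) := hwle.trans (hB.trans ((min_le_left _ _).trans (min_le_right _ _)))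
  have hw1 : w ≤ 1 := hwle.trans (hB.trans (min_le_right _ _))
  have hwb : w ≤ pcW bstar := hwR.trans (pcW_antitone hbstar0 (by rw [hR]; linarith))
  -- `n ≥ 1`
  have hn1 : 1 ≤ n := by
    by_contra h0
    have : n = 0 := by omega
    subst this
    simp at hκn; linarith
  obtain ⟨n', rfl⟩ : ∃ n', n = n' + 1 := ⟨n - 1, by omega⟩
  set μ := (Measure.pi fun _ : Fin (n' + 1) => ρB) with hμ
  have hN : ((n' + 1 : ℕ) : ℝ) = n' + 1 := by push_cast; ring
  rw [hN] at hκn hwn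
  have hNpos : (0 : ℝ) < n' + 1 := by positivity
  set s : ℝ := Real.sqrt (n' + 1) with hs
  have hs0 : 0 < s := Real.sqrt_pos.mpr hNpos
  have hss : s ^ 2 = n' + 1 := Real.sq_sqrt hNpos.le
  have hs1 : 1 ≤ s := by rw [hs]; exact Real.one_le_sqrt.mpr (by linarith [(Nat.cast_nonneg n' : (0:ℝ) ≤ n')])
  have hws : w * s ≤ 1 := by
    have h1 : (w * s) ^ 2 ≤ 1 := by rw [mul_pow, hss]; exact hwn
    have h2 : 0 ≤ w * s := by positivity
    nlinarith
  -- the window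
  set Lw : ℕ := ⌈κ' / w⌉₊ with hLw
  have hLw1 : κ' / w ≤ Lw := Nat.le_ceil _
  have hLw2 : (Lw : ℝ) < κ' / w + 1 := Nat.ceil_lt_add_one (by positivity)
  have hwLw1 : κ' ≤ w * Lw := by rw [div_le_iff₀ hw0] at hLw1; linarith
  have hwLw2 : w * Lw ≤ 2 * κ' := by
    have : w * Lw < w * (κ' / w + 1) := mul_lt_mul_of_pos_left hLw2 hw0
    rw [mul_add, mul_div_cancel₀ _ hw0.ne', mul_one] at this
    linarith
  have hNκ : κ / w ≤ n' + 1 := by rw [div_le_iff₀ hw0]; linarith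
  have hLwhalf : (Lw : ℝ) ≤ (n' + 1) / 2 := by
    have h1 : κ' / w + 1 ≤ κ / (2 * w) := by
      rw [div_add_one hw0.ne', div_le_div_iff₀ hw0 (by positivity)]
      nlinarith
    have h2 : κ / (2 * w) ≤ (n' + 1) / 2 := by
      rw [div_le_div_iff₀ (by positivity) (by norm_num : (0:ℝ) < 2)]; nlinarith
    linarith
  have hLwle : Lw ≤ n' + 1 := by
    have : (Lw : ℝ) ≤ n' + 1 := by linarith
    exact_mod_cast this
  set m₁ : ℕ := n' + 1 - Lw with hm₁def
  have hm₁le : m₁ ≤ n' + 1 := Nat.sub_le _ _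
  have hm₁cast : (m₁ : ℝ) = (n' + 1) - Lw := by
    rw [hm₁def, Nat.cast_sub hLwle]; push_cast; ring
  have hm₁2 : (n' + 1 : ℝ) ≤ 2 * m₁ := by rw [hm₁cast]; linarith
  have hm₁0 : 0 < m₁ := by
    have : (0 : ℝ) < m₁ := by linarith
    exact_mod_cast this
  have hwm₁ : κ / 2 ≤ w * m₁ := by
    rw [hm₁cast, mul_sub]; linarith
  have hwin_eq : (n' + 1 - m₁ : ℕ) = Lw := by omega
  have hwin1 : κ' ≤ w * ((n' + 1 - m₁ : ℕ) : ℝ) := by rw [hwin_eq]; exact hwLw1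
  have hwin2 : w * ((n' + 1 - m₁ : ℕ) : ℝ) ≤ 2 * κ' := by rw [hwin_eq]; exact hwLw2
  -- the test function, its mean and its primitive
  set μ₀ : ℝ := ∫ y in Set.Ico (0 : ℝ) 1, u y with hμ₀
  have hμ₀0 : 0 ≤ μ₀ := setIntegral_nonneg measurableSet_Ico fun y _ => hu0 y
  obtain ⟨Φ, hΦ0, hΦ⟩ := exists_bound_of_periodic huc huper
  obtain ⟨G₀, hG₀d, hG₀per, hG₀b⟩ := exists_periodic_primitive huc huper hu0
  set g₀ : ℝ → ℝ := fun y => u y - μ₀ with hg₀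
  have hG : ∀ y, HasDerivAt G₀ (g₀ y) y := hG₀d
  have hgc : Continuous g₀ := huc.sub continuous_const
  have hAg : ∀ y, |g₀ y| ≤ Φ + μ₀ := fun y => by
    simp only [hg₀]
    calc |u y - μ₀| ≤ |u y| + |μ₀| := abs_sub _ _
      _ ≤ Φ + μ₀ := add_le_add (hΦ y) (le_of_eq (abs_of_nonneg hμ₀0))
  have hAG : ∀ y, |G₀ y| ≤ 2 * μ₀ := hG₀b
  -- moments at `(w, n', x)`
  obtain ⟨hJ2, hQ, ⟨hEi, hE1⟩, ⟨hE2i, hE2⟩⟩ := hmom w ⟨hw0, hwb⟩ n' hwn x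
  have hJ2' : ∀ i, i ≤ n' + 1 → ∫ b, vaJ w x (finExt b) i ^ 2 ∂μ ≤ CJ := fun i hi => (hJ2 i hi).2
  obtain ⟨hM2, hM3, hLa⟩ := moments_martingale hτ S hρ hw0 hwR hh hH' hJ2 hCℓ (x := x)
  have h4b : 0 ≤ 4 * bstar ^ 2 * CJ := by positivity
  have hCMge1 : 4 * bstar ^ 2 * CJ ≤ CM :=
    le_mul_of_one_le_right h4b (le_add_of_nonneg_right (sq_nonneg H'))
  have hCMge2 : 4 * bstar ^ 2 * H' ^ 2 * CJ ≤ CM := by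
    have e1 : 4 * bstar ^ 2 * H' ^ 2 * CJ = (4 * bstar ^ 2 * CJ) * H' ^ 2 := by ring
    have e2 : CM = (4 * bstar ^ 2 * CJ) * (1 + H' ^ 2) := by rw [hCM]
    rw [e1, e2]
    exact mul_le_mul_of_nonneg_left (le_add_of_nonneg_left zero_le_one) h4b
  have hN3 : (0 : ℝ) ≤ ((n' : ℝ) + 1) ^ 3 := by positivity
  have hM2' := hM2.trans (mul_le_mul_of_nonneg_right hCMge1 hN3)
  have hM3' := hM3.trans (mul_le_mul_of_nonneg_right hCMge2 hN3)
  have hLa' : ∫ b, (∑ k : Fin (n' + 1), vaA w x (finExt b) k * S.ℓ (b k)) ^ 2 ∂μ ≤ CL * (n' + 1) / w ^ 2 := by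
    rw [hCL]; exact hLa
  -- GOOD part
  have hgood := good_part_bound hτ S hρ hw0 hwR hh hH hG hgc hAg hAG hΞ hm₁le hm₁2 hm₁0 hν hws hCχ0 hCχ
    hCJ0 hCΘ0 hCM0 hCL0 hJ2' hQ hEi hM2' hM3' hLa' (x := x)
  rw [← hbstar] at hgood
  -- BAD part
  have hEφc : ContinuousOn (fun b : Fin (n' + 1) → ℝ => u (ahPhase w x (finExt b) (n' + 1)) *
      Real.exp (duT w x h (finExt b) (n' + 1))) (Set.pi Set.univ fun _ : Fin (n' + 1) => Set.Ioo (-R) R) :=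
    (huc.comp_continuousOn (continuousOn_ahPhase_pi hR0 hw0.le hwR x (n' + 1))).mul
      (Real.continuous_exp.comp_continuousOn (continuousOn_duT_pi hR0 hw0.le hwR x hhc (n' + 1)))
  have hEφ : Integrable (fun b : Fin (n' + 1) → ℝ => u (ahPhase w x (finExt b) (n' + 1)) *
      Real.exp (duT w x h (finExt b) (n' + 1))) μ := (integrable_pi_of_continuousOn hτ hρ hEφc).2
  have htail' : μ {b | vaN w x (finExt b) S.ξ m₁ < 2 * ν * m₁} ≤ ENNReal.ofReal (Real.exp (-(ct * m₁))) :=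
    htail w ⟨hw0, hwt'⟩ (n' + 1) m₁ hm₁le hwm₁ x
  have hcrude' := hcrude w ⟨hw0, hwc'⟩ (n' + 1) m₁ hm₁le hwin1 hwin2 x
  have hosc : ∀ j : Fin (n' + 1), m₁ ≤ j.val → ∀ b : Fin (n' + 1) → ℝ, (∀ i, bm ≤ b i ∧ b i ≤ bp) →
      ∀ t ∈ Set.Icc bm bp, ∀ t' ∈ Set.Icc bm bp,
        Real.exp (duT w x h (finExt (Function.update b j t)) (n' + 1)) ≤
          2 * Real.exp (duT w x h (finExt (Function.update b j t')) (n' + 1)) := by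
    intro j hj b hb t ht t' ht'
    rw [finExt_update, finExt_update]
    have hB : ∀ i, |finExt b i| ≤ bstar := fun i => abs_finExt_le hb i
    have hjN : (j : ℕ) < n' + 1 := j.isLt
    have hwin : 5 * π * w * bstar * ((n' + 1 - (j : ℕ) : ℕ) : ℝ) ≤ 1 := by
      have h1 : ((n' + 1 - (j : ℕ) : ℕ) : ℝ) ≤ Lw := by exact_mod_cast (show n' + 1 - (j:ℕ) ≤ Lw by omega)
      calc 5 * π * w * bstar * ((n' + 1 - (j : ℕ) : ℕ) : ℝ) ≤ 5 * π * w * bstar * Lw :=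
            mul_le_mul_of_nonneg_left h1 (by positivity)
        _ = 5 * π * bstar * (w * Lw) := by ring
        _ ≤ 5 * π * bstar * (2 * κ') := mul_le_mul_of_nonneg_left hwLw2 (by positivity)
        _ = 10 * π * max |bm| |bp| * κ' := by rw [hbstar]; ring
        _ ≤ 1 := hκ'small
    have hexp := exp_duT_update_le (x := x) hbstar0 hw0 hwb hB hhd hH hH' hjN hwin
      (ReducedLawHyp.abs_le_of_mem ht) (ReducedLawHyp.abs_le_of_mem ht')
    refine hexp.trans (mul_le_mul_of_nonneg_right ?_ (Real.exp_pos _).le)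
    -- the exponent is `≤ C_A w ≤ log 2`
    have h1 : ((n' + 1 - (j : ℕ) : ℕ) : ℝ) ≤ Lw := by exact_mod_cast (show n' + 1 - (j:ℕ) ≤ Lw by omega)
    have hwNj : w * ((n' + 1 - (j : ℕ) : ℕ) : ℝ) ≤ 2 * κ' :=
      (mul_le_mul_of_nonneg_left h1 hw0.le).trans hwLw2
    have hexp_le : 2 * bstar * (w * (H + 6 * w * bstar * H' * ((n' + 1 - (j : ℕ) : ℕ) : ℝ))) ≤ CA * w := by
      rw [hCA]
      have : 6 * w * bstar * H' * ((n' + 1 - (j : ℕ) : ℕ) : ℝ) = 6 * bstar * H' * (w * ((n' + 1 - (j : ℕ) : ℕ) : ℝ)) := by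
        ring
      rw [this]
      have h2 : 6 * bstar * H' * (w * ((n' + 1 - (j : ℕ) : ℕ) : ℝ)) ≤ 6 * bstar * H' * (2 * κ') :=
        mul_le_mul_of_nonneg_left hwNj (by positivity)
      have h2w : 0 ≤ 2 * bstar * w := by positivity
      calc 2 * bstar * (w * (H + 6 * bstar * H' * (w * ((n' + 1 - (j : ℕ) : ℕ) : ℝ))))
          = 2 * bstar * w * H + 2 * bstar * w * (6 * bstar * H' * (w * ((n' + 1 - (j : ℕ) : ℕ) : ℝ))) := by ring
        _ ≤ 2 * bstar * w * H + 2 * bstar * w * (6 * bstar * H' * (2 * κ')) := by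
            have := mul_le_mul_of_nonneg_left h2 h2w; linarith only [this]
        _ = 2 * bstar * (H + 12 * bstar * H' * κ') * w := by ring
    have hCAw : CA * w ≤ Real.log 2 := by
      have h3 : w * (CA + 1) ≤ Real.log 2 := by rwa [le_div_iff₀ (by positivity)] at hwlog
      have h4 : w * (CA + 1) = CA * w + w := by ring
      linarith only [h3, h4, hw0.le]
    calc Real.exp (2 * bstar * (w * (H + 6 * w * bstar * H' * ((n' + 1 - (j : ℕ) : ℕ) : ℝ))))
        ≤ Real.exp (Real.log 2) := Real.exp_le_exp.mpr (hexp_le.trans hCAw)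
      _ = 2 := Real.exp_log two_pos
  have hbad := bad_part_bound S hw0 hhm huc huper hu0 hν hm₁0 hCΘ0 hCcr0 ⟨hE2i, hE2⟩ hEφ htail' hcrude' hosc
    (ρB := ρB) (x := x) (c := ct)
  -- decomposition of the integrand
  set E : (Fin (n' + 1) → ℝ) → ℝ := fun b => Real.exp (duT w x h (finExt b) (n' + 1)) with hEdef
  set χv : (Fin (n' + 1) → ℝ) → ℝ := fun b => duChi (ν * m₁) (vaN w x (finExt b) S.ξ m₁) with hχvdef
  set X : (Fin (n' + 1) → ℝ) → ℝ := fun b => ahPhase w x (finExt b) (n' + 1) with hXdef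
  have hident : ∀ b, E b * u (X b) = μ₀ * E b + g₀ (X b) * E b * χv b + u (X b) * E b * (1 - χv b) +
      (-(μ₀ * E b * (1 - χv b))) := by
    intro b; simp only [hg₀]; ring
  -- continuity ⇒ integrability of the pieces
  set Ucube : Set (Fin (n' + 1) → ℝ) := Set.pi Set.univ fun _ : Fin (n' + 1) => Set.Ioo (-R) R with hUcube
  have hEc : ContinuousOn E Ucube :=
    Real.continuous_exp.comp_continuousOn (continuousOn_duT_pi hR0 hw0.le hwR x hhc (n' + 1))
  have hXc : ContinuousOn X Ucube := continuousOn_ahPhase_pi hR0 hw0.le hwR x (n' + 1)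
  have hχc : ContinuousOn χv Ucube :=
    (continuous_duChi _).comp_continuousOn (continuousOn_vaN_pi hR0 hw0.le hwR x S.ξ_contDiff.continuous m₁)
  have hI1 : Integrable (fun b => g₀ (X b) * E b * χv b) μ :=
    (integrable_pi_of_continuousOn hτ hρ (((hgc.comp_continuousOn hXc).mul hEc).mul hχc)).2
  have hI2 : Integrable (fun b => u (X b) * E b * (1 - χv b)) μ :=
    (integrable_pi_of_continuousOn hτ hρ (((huc.comp_continuousOn hXc).mul hEc).mul
      (continuousOn_const.sub hχc))).2
  have hI3 : Integrable (fun b => -(μ₀ * E b * (1 - χv b))) μ :=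
    (integrable_pi_of_continuousOn hτ hρ ((continuousOn_const.mul hEc).mul (continuousOn_const.sub hχc))).2.neg
  have hI0 : Integrable (fun b => μ₀ * E b) μ := hEi.const_mul μ₀
  have hIuE : Integrable (fun b => E b * u (X b)) μ :=
    (integrable_pi_of_continuousOn hτ hρ (hEc.mul (huc.comp_continuousOn hXc))).2
  refine ⟨hIuE, ?_⟩
  -- split the integral
  have h01 : Integrable (fun b => μ₀ * E b + g₀ (X b) * E b * χv b) μ := hI0.add hI1
  have h012 : Integrable (fun b => μ₀ * E b + g₀ (X b) * E b * χv b + u (X b) * E b * (1 - χv b)) μ := h01.add hI2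
  have hsplit : ∫ b, E b * u (X b) ∂μ = μ₀ * ∫ b, E b ∂μ + ∫ b, g₀ (X b) * E b * χv b ∂μ +
      ∫ b, u (X b) * E b * (1 - χv b) ∂μ + ∫ b, -(μ₀ * E b * (1 - χv b)) ∂μ := by
    rw [integral_congr_ae (ae_of_all _ hident), integral_add h012 hI3, integral_add h01 hI2,
      integral_add hI0 hI1, integral_const_mul]
  have hneg : ∫ b, -(μ₀ * E b * (1 - χv b)) ∂μ ≤ 0 := by
    refine integral_nonpos fun b => ?_
    have hχ := duChi_mem (ν * m₁) (vaN w x (finExt b) S.ξ m₁)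
    have : 0 ≤ μ₀ * E b * (1 - χv b) := mul_nonneg (mul_nonneg hμ₀0 (Real.exp_pos _).le) (by
      simp only [hχvdef]; linarith only [hχ.2])
    show -(μ₀ * E b * (1 - χv b)) ≤ 0
    linarith only [this]
  have hgood' : ∫ b, g₀ (X b) * E b * χv b ∂μ ≤ 2 * μ₀ * (K₁ / (w * s)) := by
    have h1 := (le_abs_self _).trans hgood
    rw [← hK₁] at h1
    exact h1
  have hbad' : ∫ b, u (X b) * E b * (1 - χv b) ∂μ ≤ 2 * Ccr * (CΘ + 1) * μ₀ * Real.exp (-(ct * m₁ / 2)) / w := hbad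
  have hmean : μ₀ * ∫ b, E b ∂μ ≤ μ₀ * CΘ := mul_le_mul_of_nonneg_left hE1 hμ₀0
  -- `e^{-c m₁/2} ≤ 4/(c s)`
  have hexp_s : Real.exp (-(ct * m₁ / 2)) ≤ 4 / (ct * s) := by
    have hs2 : s ≤ s ^ 2 := by
      have := mul_le_mul_of_nonneg_left hs1 (zero_le_one.trans hs1)
      rw [mul_one, ← sq] at this; exact this
    have hsm : s ≤ 2 * m₁ := by rw [hss] at hs2; linarith only [hs2, hm₁2]
    have h1 : ct * s / 4 ≤ ct * m₁ / 2 := by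
      have := mul_le_mul_of_nonneg_left hsm hct.le; linarith only [this]
    have h2 : ct * s / 4 ≤ Real.exp (ct * m₁ / 2) := by
      have := Real.add_one_le_exp (ct * m₁ / 2)
      linarith only [h1, this]
    rw [Real.exp_neg, inv_eq_one_div, div_le_div_iff₀ (Real.exp_pos _) (by positivity)]
    linarith only [h2]
  -- numerics
  have hws0 : 0 < w * s := by positivity
  have hT1 : μ₀ * CΘ ≤ μ₀ * CΘ / (w * s) := by
    rw [le_div_iff₀ hws0]
    exact mul_le_of_le_one_right (mul_nonneg hμ₀0 hCΘ0) hws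
  have hT3 : 2 * Ccr * (CΘ + 1) * μ₀ * Real.exp (-(ct * m₁ / 2)) / w ≤ 8 * Ccr * (CΘ + 1) / ct * μ₀ / (w * s) := by
    have h0 : 0 ≤ 2 * Ccr * (CΘ + 1) * μ₀ := by positivity
    calc 2 * Ccr * (CΘ + 1) * μ₀ * Real.exp (-(ct * m₁ / 2)) / w
        ≤ 2 * Ccr * (CΘ + 1) * μ₀ * (4 / (ct * s)) / w :=
          div_le_div_of_nonneg_right (mul_le_mul_of_nonneg_left hexp_s h0) hw0.le
      _ = 8 * Ccr * (CΘ + 1) / ct * μ₀ / (w * s) := by field_simp; ring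
  have htotal : ∫ b, E b * u (X b) ∂μ ≤ K / (w * s) * μ₀ := by
    rw [hsplit]
    have hKexp : K / (w * s) * μ₀ = μ₀ * CΘ / (w * s) + 2 * μ₀ * (K₁ / (w * s)) +
        8 * Ccr * (CΘ + 1) / ct * μ₀ / (w * s) + μ₀ / (w * s) := by
      rw [hK]; field_simp
    rw [hKexp]
    have hlast : 0 ≤ μ₀ / (w * s) := by positivity
    linarith only [hmean, hT1, hgood', hbad', hT3, hneg, hlast]
  -- back to the statement's notation
  have hgoal : ∫ B, Real.exp (w * ∑ k ∈ Finset.range (n' + 1), h (ahPhase w x (finExt B) k) * finExt B k) *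
      u (ahPhase w x (finExt B) (n' + 1)) ∂μ = ∫ b, E b * u (X b) ∂μ := rfl
  rw [hgoal, hN]
  exact htotal

end Assembly

end Literature.Barriers.AtomisticToContinuum.HeatConduction

end
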